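import Literature.Combinatorics.Sahi2008.Indicators
import HarnessLib

/-!
# Sahi's `E_n` as an `n`-fold sum: the recursive `n`-copy kernel

Support file (Sahi cell `prim-sahi`, seat `prim-sahi-typer`, generation 26; `--supports stmt-CriticalPhenomena-4575`).
Pure algebra, no `sorry`, standard axioms.  This is the order-`n` replacement for the three-copy identity
`SahiGrid3.latticeE3_eq_sum_copies` on which the pattern functional `SahiGridPattern.sStarD` (order `3`) is built; the
companion file `SahiGridPatternOrderN` uses it to define the pattern functional `sStarN n d` on the small cube `[n]^d` for
EVERY order `n` and to reduce Sahi's conjecture `C_n` to one finite inequality per dimension.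

THE MATHEMATICS.  The tree DEFINES `E_n = sahiE μ n` by the Lieb–Sahi recursion [LiebSahi2021, Prop. 3.3]
`E_{n+2}(f_0, g) = Σ_i E_{n+1}(g with g_i ↦ g_i f_0) − E_{n+1}(g)·E(f_0)`, `E_1(f) = E(f)`.  Mirror the recursion on
`n × n` "incidence matrices" `M i c` (slot `i`, copy `c`) over any commutative ring:
  `K_0 = 0`, `K_1(M) = M 0 0`,
  `K_{n+2}(M) = Σ_{i ≤ n} K_{n+1}(M⁺ with row i multiplied entrywise by (c ↦ M 0 c⁺)) − K_{n+1}(M⁺)·M 0 0`,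
where `M⁺ j c = M j⁺ c⁺` drops slot `0` and copy `0` (`copyKernel`).  Then for every probability weight `μ` on a finite
type and every family `f : Fin n → α → ℝ`:
  **`sahiE μ n f = Σ_{ω : Fin n → α} (∏_c μ(ω_c)) · K_n(i c ↦ f_i(ω_c))`**   (`sahiE_eq_sum_copyKernel`)
— `E_n` is the expectation, over `n` INDEPENDENT copies `ω_0,…,ω_{n−1}` of the state, of a universal multilinear kernel in
the values `f_i(ω_c)`: the distinguished function `f_0` of the recursion is evaluated at the copy `ω_0` that the recursive
call does not use.  Unfolded, `K_n(M) = Σ_P (−1)^{|P|−1} ∏_{B ∈ P} (|B|−1)! ∏_{i ∈ B} M i c(B)` over the set partitions `P`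
of the slots with one copy `c(B)` per block (Sahi's coefficients [Sahi2008, (4)–(7)]; e.g. `K_2(M) = M₁₁M₀₁ − M₁₁M₀₀`,
and `K_3` has the five terms `2, −1, −1, −1, +1` of `SahiGrid3.hZ` up to relabelling the copies) — this closed form is
not needed and not proved here.  For indicator families `f_i = 1_{A_i}` the kernel is an INTEGER, `copyKernel` over `ℤ`
of the Boolean incidence matrix `[ω_c ∈ A_i]` (`sahiE_setInd_eq_sum_copyKernel`).

References: [LiebSahi2021] E. H. Lieb, S. Sahi, J. Math. Phys. 63 (2022) 043301, Prop. 3.3; [Sahi2008] S. Sahi,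
Combinatorica 28 (2008), (4)–(7).  The `n`-copy presentation along the recursion is this work.
-/

namespace Summit.CriticalPhenomena.PercolationContinuityZ3.Theorems.SahiCopyKernel

open Finset Literature.Combinatorics.Sahi2008
open scoped BigOperators

noncomputable section

/-! ### The kernel -/

/-- Drop slot `0` and copy `0` of an `(n+1) × (n+1)` incidence matrix: `M⁺ j c = M j.succ c.succ`. [this work] -/
def mtail {R : Type*} {n : ℕ} (M : Fin (n + 1) → Fin (n + 1) → R) : Fin n → Fin n → R :=
  fun j c => M j.succ c.succ

/-- **The recursive `n`-copy kernel** `K_n(M)` of an `n × n` matrix over a commutative ring, mirroring the Lieb–Sahi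
recursion that defines `sahiE` (distinguished slot `0`, evaluated at the otherwise unused copy `0`). [this work] -/
def copyKernel {R : Type*} [CommRing R] : (n : ℕ) → (Fin n → Fin n → R) → R
  | 0, _ => 0
  | 1, M => M 0 0
  | n + 2, M =>
      (∑ i : Fin (n + 1), copyKernel (n + 1) (Function.update (mtail M) i (fun c => mtail M i c * M 0 c.succ))) -
        copyKernel (n + 1) (mtail M) * M 0 0

/-- `K_0 = 0`. [this work] -/
theorem copyKernel_zero {R : Type*} [CommRing R] (M : Fin 0 → Fin 0 → R) : copyKernel 0 M = 0 := rfl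

/-- `K_1(M) = M 0 0`. [this work] -/
theorem copyKernel_one {R : Type*} [CommRing R] (M : Fin 1 → Fin 1 → R) : copyKernel 1 M = M 0 0 := rfl

/-- The recursion step of `K_{n+2}`. [this work] -/
theorem copyKernel_succ_succ {R : Type*} [CommRing R] (n : ℕ) (M : Fin (n + 2) → Fin (n + 2) → R) :
    copyKernel (n + 2) M =
      (∑ i : Fin (n + 1), copyKernel (n + 1) (Function.update (mtail M) i (fun c => mtail M i c * M 0 c.succ))) -
        copyKernel (n + 1) (mtail M) * M 0 0 := rfl

/-- The kernel commutes with ring homomorphisms (used for the cast `ℤ → ℝ`). [this work] -/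
theorem map_copyKernel {R S : Type*} [CommRing R] [CommRing S] (φ : R →+* S) :
    ∀ (n : ℕ) (M : Fin n → Fin n → R), φ (copyKernel n M) = copyKernel n (fun i c => φ (M i c))
  | 0, M => by simp [copyKernel]
  | 1, M => by simp [copyKernel]
  | n + 2, M => by
      rw [copyKernel_succ_succ, copyKernel_succ_succ, map_sub, map_mul, map_sum]
      congr 1
      · refine Finset.sum_congr rfl fun i _ => ?_
        rw [map_copyKernel φ (n + 1)]
        congr 1
        funext j c
        by_cases hj : j = i
        · subst hj
          simp only [Function.update_self, map_mul, mtail]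
        · simp only [Function.update_of_ne hj, mtail]
      · rw [map_copyKernel φ (n + 1)]
        rfl

/-! ### The `n`-copy identity -/

variable {α : Type*}

/-- The incidence matrix `M i c = f_i(ω_c)` of a family `f` at `n` copies `ω`. [this work] -/
def valMatrix {n : ℕ} (f : Fin n → α → ℝ) (ω : Fin n → α) : Fin n → Fin n → ℝ := fun i c => f i (ω c)

/-- `(valMatrix f (Fin.cons x ω))⁺ = valMatrix (Fin.tail f) ω`. [this work] -/
theorem mtail_valMatrix_cons {n : ℕ} (f : Fin (n + 1) → α → ℝ) (x : α) (ω : Fin n → α) :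
    mtail (valMatrix f (Fin.cons x ω : Fin (n + 1) → α)) = valMatrix (Fin.tail f) ω := by
  funext j c
  simp only [mtail, valMatrix, Fin.cons_succ, Fin.tail]

/-- The updated matrix of the recursion is the matrix of the updated family. [this work] -/
theorem update_valMatrix {n : ℕ} (f : Fin (n + 2) → α → ℝ) (x : α) (ω : Fin (n + 1) → α) (i : Fin (n + 1)) :
    Function.update (mtail (valMatrix f (Fin.cons x ω : Fin (n + 2) → α))) i
        (fun c => mtail (valMatrix f (Fin.cons x ω : Fin (n + 2) → α)) i c *
          valMatrix f (Fin.cons x ω : Fin (n + 2) → α) 0 c.succ) =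
      valMatrix (Function.update (Fin.tail f) i (Fin.tail f i * f 0)) ω := by
  funext j c
  by_cases hj : j = i
  · subst hj
    simp only [Function.update_self, mtail, valMatrix, Fin.cons_succ, Fin.tail, Pi.mul_apply]
  · simp only [Function.update_of_ne hj, mtail, valMatrix, Fin.cons_succ, Fin.tail]

/-- `valMatrix f (Fin.cons x ω) 0 0 = f 0 x`. [this work] -/
theorem valMatrix_cons_zero_zero {n : ℕ} (f : Fin (n + 1) → α → ℝ) (x : α) (ω : Fin n → α) :
    valMatrix f (Fin.cons x ω : Fin (n + 1) → α) 0 0 = f 0 x := by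
  simp only [valMatrix, Fin.cons_zero]

variable [Fintype α]

/-- Splitting a sum over `n+1` copies into the copy `0` and the remaining `n` copies. [folklore] -/
theorem sum_copies_succ {n : ℕ} (F : (Fin (n + 1) → α) → ℝ) :
    ∑ ω : Fin (n + 1) → α, F ω = ∑ x : α, ∑ ω : Fin n → α, F (Fin.cons x ω) := by
  rw [← Fintype.sum_equiv (Fin.consEquiv fun _ : Fin (n + 1) => α) (fun p => F (Fin.cons p.1 p.2)) F
    (fun _ => rfl), Fintype.sum_prod_type]

/-- The bookkeeping identity of the inductive step (plumbing). [folklore] -/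
theorem sum_sum_mul_sub {β ι : Type*} [Fintype β] [Fintype ι] (μ g : α → ℝ) (hμ : ∑ x, μ x = 1)
    (P T : β → ℝ) (K : ι → β → ℝ) :
    ∑ x, ∑ ω, μ x * (P ω * ((∑ i, K i ω) - T ω * g x)) =
      (∑ i, ∑ ω, P ω * K i ω) - (∑ ω, P ω * T ω) * ∑ x, μ x * g x := by
  calc ∑ x, ∑ ω, μ x * (P ω * ((∑ i, K i ω) - T ω * g x))
      = ∑ x, (μ x * (∑ ω, P ω * ∑ i, K i ω) - (μ x * g x) * ∑ ω, P ω * T ω) := by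
        refine Finset.sum_congr rfl fun x _ => ?_
        rw [Finset.mul_sum, Finset.mul_sum, ← Finset.sum_sub_distrib]
        refine Finset.sum_congr rfl fun ω _ => ?_
        ring
    _ = (∑ x, μ x) * (∑ ω, P ω * ∑ i, K i ω) - (∑ x, μ x * g x) * ∑ ω, P ω * T ω := by
        rw [Finset.sum_sub_distrib, Finset.sum_mul, Finset.sum_mul]
    _ = (∑ i, ∑ ω, P ω * K i ω) - (∑ ω, P ω * T ω) * ∑ x, μ x * g x := by
        rw [hμ, one_mul, mul_comm (∑ x, μ x * g x)]
        congr 1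
        simp_rw [Finset.mul_sum]
        exact Finset.sum_comm

/-- **The `n`-copy identity**: for a probability weight `μ`,
`sahiE μ n f = Σ_{ω : Fin n → α} (∏_c μ(ω_c)) · K_n(i c ↦ f_i(ω_c))`. [this work] -/
theorem sahiE_eq_sum_copyKernel (μ : α → ℝ) (hμ : ∑ x, μ x = 1) :
    ∀ (n : ℕ) (f : Fin n → α → ℝ),
      sahiE μ n f = ∑ ω : Fin n → α, (∏ c, μ (ω c)) * copyKernel n (valMatrix f ω)
  | 0, f => by simp [sahiE_zero, copyKernel]
  | 1, f => by
      rw [sahiE_one_apply, ex_def]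
      refine (Fintype.sum_equiv (Equiv.funUnique (Fin 1) α) _ _ fun ω => ?_).symm
      simp [copyKernel, valMatrix]
  | n + 2, f => by
      have IH := sahiE_eq_sum_copyKernel μ hμ (n + 1)
      have hstep : ∀ (x : α) (ω : Fin (n + 1) → α),
          (∏ c, μ ((Fin.cons x ω : Fin (n + 2) → α) c)) * copyKernel (n + 2) (valMatrix f (Fin.cons x ω)) =
            μ x * ((∏ c, μ (ω c)) *
              ((∑ i : Fin (n + 1), copyKernel (n + 1)
                  (valMatrix (Function.update (Fin.tail f) i (Fin.tail f i * f 0)) ω)) -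
                copyKernel (n + 1) (valMatrix (Fin.tail f) ω) * f 0 x)) := by
        intro x ω
        rw [Fin.prod_univ_succ, copyKernel_succ_succ]
        simp only [Fin.cons_zero, Fin.cons_succ, update_valMatrix]
        rw [mtail_valMatrix_cons, valMatrix_cons_zero_zero, mul_assoc]
      rw [sahiE_succ_succ, sum_copies_succ]
      simp_rw [hstep, IH]
      rw [sum_sum_mul_sub μ (f 0) hμ, ex_def]

/-! ### Indicator families: the integer kernel -/

variable [DecidableEq α]

/-- The Boolean incidence matrix `[ω_c ∈ A_i]` of a family of finsets at `n` copies, as a `0/1` integer matrix.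
[this work] -/
def incMatrix {n : ℕ} (A : Fin n → Finset α) (ω : Fin n → α) : Fin n → Fin n → ℤ :=
  fun i c => if ω c ∈ A i then 1 else 0

omit [Fintype α] in
/-- The real incidence matrix of the indicator family is the cast of the integer one. [this work] -/
theorem valMatrix_setInd {n : ℕ} (A : Fin n → Finset α) (ω : Fin n → α) :
    valMatrix (fun i => setInd (A i)) ω = fun i c => ((incMatrix A ω i c : ℤ) : ℝ) := by
  funext i c
  unfold valMatrix incMatrix setInd
  by_cases h : ω c ∈ A i <;> simp [h]

/-- **`E_n` of indicators as an integer `n`-copy sum**: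
`sahiE μ n (1_{A_0},…,1_{A_{n−1}}) = Σ_ω (∏_c μ(ω_c)) · K_n([ω_c ∈ A_i])` with the INTEGER kernel. [this work] -/
theorem sahiE_setInd_eq_sum_copyKernel (μ : α → ℝ) (hμ : ∑ x, μ x = 1) (n : ℕ) (A : Fin n → Finset α) :
    sahiE μ n (fun i => setInd (A i)) =
      ∑ ω : Fin n → α, (∏ c, μ (ω c)) * ((copyKernel n (incMatrix A ω) : ℤ) : ℝ) := by
  rw [sahiE_eq_sum_copyKernel μ hμ n]
  refine Finset.sum_congr rfl fun ω _ => ?_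
  have h := map_copyKernel (Int.castRingHom ℝ) n (incMatrix A ω)
  simp only [eq_intCast] at h
  rw [valMatrix_setInd, ← h]

end

end Summit.CriticalPhenomena.PercolationContinuityZ3.Theorems.SahiCopyKernel
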